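import Mathlib
import Literature.NumberTheory.Transcendental.KZCalculusProofs
import Literature.NumberTheory.Transcendental.KZLogCalculusProofs
import Literature.NumberTheory.Transcendental.KZSemialgebraicComplex
import Summits.KontsevichZagierPeriods.KontsevichZagierPeriods.Theorems.HyperbolicBlochOffTetraSectorKernelStubGoldenDilog
import Summits.KontsevichZagierPeriods.KontsevichZagierPeriods.Theorems.HyperbolicBlochOffTetraSectorKernelStubCarrierExistence

/-!
# `OffTetraSectorKernel`, line `odd-hyperbolic-ladder`: existence of the `Li₂(1)`-triangle
(stub `stub_dilogOneExists`)

A registered existence stub of the crux `OffTetraSectorKernel`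
(stmt-KontsevichZagierPeriods-10557, route HyperbolicBloch). Every statement of the line about
`Li₂(1) = π²/6` inside the Kontsevich–Zagier calculus (Euler reflection, Basel, the golden
evaluations) takes the `Li₂(1)`-triangle `L₁ = [{0 < t < u < 1}, 1/(u(1 − t))]` as a hypothesis;
this file constructs it, i.e. proves that it IS an integral representation (`KZ.IntegralRep`):
the open triangle is `ℚ`-semialgebraic, `1/(u(1 − t))` is a rational function with non-vanishing
denominator on it, and — the only work, the limit case `a = 1` of
`dilogCarrier_integrableOn_band` — the integral converges absolutely.

Absolute convergence: the triangle sits inside the closed-fibre band `{0 < u < 1, 0 ≤ t ≤ u}`;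
on the fibre over `u` one has `1/(u(1 − t)) ≤ 1/u + 1/(1 − t)` (this is `t ≤ u`), whose fibre
integral is `1 − log(1 − u)`, an integrable function of `u ∈ (0, 1)` (`log` is integrable at
`0⁺`); `KZlog.integrableOn_band_of_lintegral_fibre_le` (Tonelli along the fibre) concludes.

References: M. Kontsevich, D. Zagier, *Periods* (2001), §1.1 (`ζ(2) = ∫∫_{0<t<u<1} du dt/(u(1−t))`
is the very first example of a period given by an integral over a semialgebraic domain).
No definitions are introduced.
-/

noncomputable section

open Set MeasureTheory MvPolynomial
open Literature.NumberTheory.Transcendental Literature.ModelTheory.ExponentialFields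

namespace Summit.KontsevichZagierPeriods.HyperbolicBloch.OffTetraSectorKernel

/-- Integrability of `1/(u(1 − t))` on the closed-fibre band `{0 < u < 1, 0 ≤ t ≤ u}` (the limit
case `a = 1` of `dilogCarrier_integrableOn_band`): on the fibre over `u` the integrand is at most
`1/u + 1/(1 − t)` (equivalent to `t ≤ u`), so the fibre integral is at most `1 − log(1 − u)`,
which is integrable on `(0, 1)` (`intervalIntegral.intervalIntegrable_log'`); Tonelli along the
fibre (`KZlog.integrableOn_band_of_lintegral_fibre_le`). [folklore] -/
theorem dilogOne_integrableOn_band :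
    IntegrableOn (fun w : Fin 2 → ℝ => 1 / (w 0 * (1 - w 1)))
      (KZlog.band {x : Fin 1 → ℝ | 0 < x 0 ∧ x 0 < 1} (fun _ => 0) (fun x => x 0)) := by
  have hS : IsSemialgebraic ℚ {x : Fin 1 → ℝ | 0 < x 0 ∧ x 0 < 1} :=
    dilogCarrier_isSemialgebraic_base isAlgebraic_one
  have hSm : MeasurableSet {x : Fin 1 → ℝ | 0 < x 0 ∧ x 0 < 1} :=
    IsSemialgebraic.measurableSet_holds hS
  have hB : IsSemialgebraic ℚ
      (KZlog.band {x : Fin 1 → ℝ | 0 < x 0 ∧ x 0 < 1} (fun _ => 0) (fun x => x 0)) :=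
    KZlog.isSemialgebraic_band (isSemialgebraicFunOn_const_of_isAlgebraic hS isAlgebraic_zero)
      (isSemialgebraicFunOn_apply hS 0)
  have hBm : MeasurableSet
      (KZlog.band {x : Fin 1 → ℝ | 0 < x 0 ∧ x 0 < 1} (fun _ => 0) (fun x => x 0)) :=
    IsSemialgebraic.measurableSet_holds hB
  have hWm : Measurable (fun w : Fin 2 → ℝ => 1 / (w 0 * (1 - w 1))) :=
    measurable_const.div ((measurable_pi_apply 0).mul (measurable_const.sub (measurable_pi_apply 1)))
  -- the majorant `K(u) = 1 - log (1 - u)` of the fibre integrals is integrable on `(0, 1)`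
  have hlog : IntegrableOn (fun u : ℝ => Real.log (1 - u)) (Ioo (0 : ℝ) 1) := by
    rw [← intervalIntegrable_iff_integrableOn_Ioo_of_le zero_le_one]
    simpa using (intervalIntegral.intervalIntegrable_log' (a := 1) (b := 0)).comp_sub_left 1
  have hK1 : IntegrableOn (fun u : ℝ => 1 - Real.log (1 - u)) (Ioo (0 : ℝ) 1) :=
    (integrableOn_const measure_Ioo_lt_top.ne).sub hlog
  have hK : IntegrableOn (fun x : Fin 1 → ℝ => 1 - Real.log (1 - x 0))
      {x : Fin 1 → ℝ | 0 < x 0 ∧ x 0 < 1} := by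
    have h2 : IntegrableOn (fun x : Fin 1 → ℝ => (fun u : ℝ => 1 - Real.log (1 - u)) (x 0))
        {x : Fin 1 → ℝ | x 0 ∈ Ioo (0 : ℝ) 1} :=
      ((volume_preserving_funUnique (Fin 1) ℝ).integrableOn_comp_preimage
        (MeasurableEquiv.funUnique (Fin 1) ℝ).measurableEmbedding).2 hK1
    simpa using h2
  -- the fibre integrals
  have hfib : ∀ x ∈ {x : Fin 1 → ℝ | 0 < x 0 ∧ x 0 < 1},
      ∫⁻ t in Icc (0 : ℝ) (x 0),
        ‖(1 : ℝ) / ((Fin.snoc x t : Fin 2 → ℝ) 0 * (1 - (Fin.snoc x t : Fin 2 → ℝ) 1))‖ₑ ≤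
        ‖1 - Real.log (1 - x 0)‖ₑ := by
    rintro x ⟨hx0, hx1⟩
    have h1x : 0 < 1 - x 0 := by linarith
    have hle : ∀ t ∈ Icc (0 : ℝ) (x 0),
        ‖(1 : ℝ) / ((Fin.snoc x t : Fin 2 → ℝ) 0 * (1 - (Fin.snoc x t : Fin 2 → ℝ) 1))‖ₑ ≤
          ENNReal.ofReal ((x 0)⁻¹ + (1 - t)⁻¹) := by
      intro t ht
      have e0 : (Fin.snoc x t : Fin 2 → ℝ) 0 = x 0 := rfl
      have e1 : (Fin.snoc x t : Fin 2 → ℝ) 1 = t := rfl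
      rw [e0, e1]
      have h1t : 0 < 1 - t := by linarith [ht.2]
      have hpos : 0 < x 0 * (1 - t) := mul_pos hx0 h1t
      rw [Real.enorm_eq_ofReal (one_div_pos.2 hpos).le]
      refine ENNReal.ofReal_le_ofReal ?_
      rw [div_le_iff₀ hpos]
      have hmul : ((x 0)⁻¹ + (1 - t)⁻¹) * (x 0 * (1 - t)) = (1 - t) + x 0 := by
        field_simp
      rw [hmul]
      linarith [ht.2]
    have hc2 : ContinuousOn (fun t : ℝ => (1 - t)⁻¹) (Icc 0 (x 0)) :=
      ContinuousOn.inv₀ (continuousOn_const.sub continuousOn_id) fun t ht =>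
        (sub_pos.2 (ht.2.trans_lt hx1)).ne'
    have hcont : ContinuousOn (fun t : ℝ => (x 0)⁻¹ + (1 - t)⁻¹) (Icc 0 (x 0)) :=
      continuousOn_const.add hc2
    have hint : IntegrableOn (fun t : ℝ => (x 0)⁻¹ + (1 - t)⁻¹) (Icc 0 (x 0)) :=
      hcont.integrableOn_Icc
    have hnn : 0 ≤ᵐ[volume.restrict (Icc 0 (x 0))] fun t : ℝ => (x 0)⁻¹ + (1 - t)⁻¹ :=
      (ae_restrict_mem measurableSet_Icc).mono fun t ht =>
        add_nonneg (inv_nonneg.2 hx0.le) (inv_nonneg.2 (by linarith [ht.2]))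
    have hval : ∫ t in Icc 0 (x 0), ((x 0)⁻¹ + (1 - t)⁻¹) = 1 - Real.log (1 - x 0) := by
      rw [integral_Icc_eq_integral_Ioc, ← intervalIntegral.integral_of_le hx0.le,
        intervalIntegral.integral_add intervalIntegrable_const (hc2.intervalIntegrable_of_Icc hx0.le),
        intervalIntegral.integral_const, intervalIntegral.integral_comp_sub_left Inv.inv 1, sub_zero,
        sub_zero, integral_inv_of_pos h1x one_pos, one_div, Real.log_inv, smul_eq_mul,
        mul_inv_cancel₀ hx0.ne']
      ring
    calc ∫⁻ t in Icc (0 : ℝ) (x 0),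
          ‖(1 : ℝ) / ((Fin.snoc x t : Fin 2 → ℝ) 0 * (1 - (Fin.snoc x t : Fin 2 → ℝ) 1))‖ₑ
        ≤ ∫⁻ t in Icc (0 : ℝ) (x 0), ENNReal.ofReal ((x 0)⁻¹ + (1 - t)⁻¹) :=
          setLIntegral_mono' measurableSet_Icc hle
      _ = ENNReal.ofReal (∫ t in Icc 0 (x 0), ((x 0)⁻¹ + (1 - t)⁻¹)) :=
          (ofReal_integral_eq_lintegral_ofReal hint hnn).symm
      _ = ‖1 - Real.log (1 - x 0)‖ₑ := by
          rw [hval, Real.enorm_eq_ofReal]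
          linarith [Real.log_nonpos h1x.le (by linarith : 1 - x 0 ≤ 1)]
  exact KZlog.integrableOn_band_of_lintegral_fibre_le hSm hBm (fun x t => KZlog.snoc_mem_band)
    hWm.aestronglyMeasurable hfib hK

/-- STUB `stub_dilogOneExists`: the `Li₂(1)`-triangle `[{0 < t < u < 1}, 1/(u(1 − t))]` (value
`Li₂(1) = ζ(2)`) IS an integral representation: the open triangle is `ℚ`-semialgebraic, the
integrand is a rational function with non-vanishing denominator on it, and the integral converges
absolutely (the triangle sits inside the closed-fibre band `{0 < u < 1, 0 ≤ t ≤ u}`, on which the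
fibre integrals are dominated by the integrable `1 − log(1 − u)`: `dilogOne_integrableOn_band`).
[cite: KontsevichZagier2001, §1.1] -/
theorem stub_dilogOneExists :
    ∃ L : KZ.IntegralRep 2, L.domain = {w | 0 < w 1 ∧ w 1 < w 0 ∧ w 0 < 1} ∧
      L.integrand = fun w => 1 / (w 0 * (1 - w 1)) := by
  have hT : IsSemialgebraic ℚ {w : Fin 2 → ℝ | 0 < w 1 ∧ w 1 < w 0 ∧ w 0 < 1} :=
    goldenDilog_isSemialgebraic_triangle isAlgebraic_one
  have hq : ∀ w ∈ {w : Fin 2 → ℝ | 0 < w 1 ∧ w 1 < w 0 ∧ w 0 < 1},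
      aeval w (X 0 * (1 - X 1) : MvPolynomial (Fin 2) ℚ) ≠ 0 := by
    rintro w ⟨h1, h2, h3⟩
    have h : (0 : ℝ) < w 0 * (1 - w 1) := mul_pos (h1.trans h2) (by linarith)
    simpa only [map_mul, map_sub, map_one, MvPolynomial.aeval_X] using h.ne'
  have hf : IsSemialgebraicFunOn ℚ {w : Fin 2 → ℝ | 0 < w 1 ∧ w 1 < w 0 ∧ w 0 < 1}
      (fun w => 1 / (w 0 * (1 - w 1))) :=
    (isSemialgebraicFunOn_aeval_div_aeval hT 1 _ hq).congr fun w _ => by simp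
  have hint : IntegrableOn (fun w : Fin 2 → ℝ => 1 / (w 0 * (1 - w 1)))
      {w : Fin 2 → ℝ | 0 < w 1 ∧ w 1 < w 0 ∧ w 0 < 1} := by
    refine dilogOne_integrableOn_band.mono_set ?_
    rintro w ⟨h1, h2, h3⟩
    exact ⟨⟨h1.trans h2, h3⟩, h1.le, h2.le⟩
  exact ⟨⟨_, _, hT, hf, hint⟩, rfl, rfl⟩

end Summit.KontsevichZagierPeriods.HyperbolicBloch.OffTetraSectorKernel

end
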